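import Summits.Ventures.HodgeRepro2.PeterssonNormalizer

/-!
# Hecke operators on weight-`k` forms for `S`: double-coset sums, weight preservation

Kernel support for the blind cell pub-hodge-repro2 (seat p2), Tier 5 (the Hecke side of the sub-steps
N3 / N5).  For `δ ∈ U(H)(K)` and the arithmetic group `S`, with `S_δ := S ∩ δ⁻¹ S δ` of finite index in
`S` and right-coset representatives `r_q := (out q)⁻¹` (`q ∈ S ⧸ S_δ`, so `S = ⋃_q S_δ r_q` and
`S δ S = ⋃_q S δ r_q`), the Hecke operator is the double-coset sum

  `T_δ f := ∑_q f ∥_k (δ r_q)`.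

Proved here: `T_δ` maps weight-`k` functions for `S` to weight-`k` functions for `S` (the classical
re-indexing `r_q γ = t r_{γ⁻¹·q}` with `t ∈ S_δ`, `δ t δ⁻¹ ∈ S`), and preserves continuity on the ball.
Self-adjointness for the Petersson product is the subject of a later file.
-/

namespace Summit.Ventures.HodgeRepro2.ShimuraData

open scoped Pointwise

section Defs

variable {K : Type*} [Field K] (S : Subgroup (GL (Fin 3) K)) (δ : GL (Fin 3) K)

/-- `S_δ := S ∩ δ⁻¹ S δ = {γ ∈ S | δ γ δ⁻¹ ∈ S}`. -/
def heckeSubgroup : Subgroup (GL (Fin 3) K) :=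
  S ⊓ S.comap (MulAut.conj δ).toMonoidHom

/-- Membership in `S_δ`. -/
theorem mem_heckeSubgroup {γ : GL (Fin 3) K} :
    γ ∈ heckeSubgroup S δ ↔ γ ∈ S ∧ δ * γ * δ⁻¹ ∈ S := by
  simp [heckeSubgroup, MulAut.conj_apply]

/-- `S_δ ≤ S`. -/
theorem heckeSubgroup_le : heckeSubgroup S δ ≤ S := inf_le_left

/-- The left-multiplication action of `S` on the cosets `S ⧸ S_δ` (made an instance here so that
`γ • q` is found without a long typeclass search through `GL`). -/
instance heckeQuotientAction : MulAction S (S ⧸ (heckeSubgroup S δ).subgroupOf S) :=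
  MulAction.quotient S _

/-- The right-coset representatives `r_q := (out q)⁻¹`, `q ∈ S ⧸ S_δ`. -/
noncomputable def heckeRep (q : S ⧸ (heckeSubgroup S δ).subgroupOf S) : S := (Quotient.out q)⁻¹

/-- Re-indexing the representatives by right multiplication with `γ ∈ S`:
`r_q γ = t · r_{γ⁻¹ • q}` with `t ∈ S_δ`. -/
theorem heckeRep_mul (q : S ⧸ (heckeSubgroup S δ).subgroupOf S) (γ : S) :
    ∃ t : S, (t : GL (Fin 3) K) ∈ heckeSubgroup S δ ∧ heckeRep S δ q * γ = t * heckeRep S δ (γ⁻¹ • q) := by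
  obtain ⟨t, ht⟩ := QuotientGroup.mk_out_eq_mul ((heckeSubgroup S δ).subgroupOf S) (γ⁻¹ * Quotient.out q)
  refine ⟨(t : S), Subgroup.mem_subgroupOf.mp t.property, ?_⟩
  unfold heckeRep
  rw [← QuotientGroup.out_eq' q, MulAction.Quotient.smul_mk, QuotientGroup.out_eq', smul_eq_mul, ht]
  group

/-- **The Hecke operator** `T_δ f := ∑_q f ∥_k (δ r_q)` (sum over `S ⧸ S_δ`). -/
noncomputable def hecke (τ₁ : K →+* ℂ) (Q : Matrix (Fin 3) (Fin 3) ℂ) (k : ℕ)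
    [Fintype (S ⧸ (heckeSubgroup S δ).subgroupOf S)] (f : (Fin 2 → ℂ) → ℂ) : (Fin 2 → ℂ) → ℂ :=
  fun z => ∑ q, slash k (realEmbedding K τ₁ Q (δ * (heckeRep S δ q : GL (Fin 3) K))) f z

end Defs

section Weight

variable {K : Type*} [Field K] [NumberField K] [NumberField.IsCMField K]
    {τ₁ : K →+* ℂ} {H : Matrix (Fin 3) (Fin 3) K} {Q : Matrix (Fin 3) (Fin 3) ℂ}

/-- Pointwise form of the slash: `(f ∥ α)(γ z) = j(γ, z)^k · ((f ∥ α) ∥ γ)(z)`. -/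
theorem apply_ballAction_eq_autFactor_pow_mul_slash (k : ℕ) (α γ : Matrix (Fin 3) (Fin 3) ℂ)
    (hγ : IsInU21 γ) (f : (Fin 2 → ℂ) → ℂ) {z : Fin 2 → ℂ} (hz : z ∈ ball₂) :
    slash k α f (ballAction γ z) = autFactor γ z ^ k * slash k γ (slash k α f) z := by
  have hD : autFactor γ z ^ k ≠ 0 := pow_ne_zero _ (IsInU21.autFactor_ne_zero hγ hz)
  show slash k α f (ballAction γ z) = autFactor γ z ^ k * ((autFactor γ z ^ k)⁻¹ * slash k α f (ballAction γ z))
  rw [← mul_assoc, mul_inv_cancel₀ hD, one_mul]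

/-- For `s ∈ S` and `f` of weight `k` for `S`, `f ∥_k (s α) = f ∥_k α` on the ball. -/
theorem slash_mul_mem_eq (hQ : IsFrame K τ₁ H Q) (S : Subgroup (GL (Fin 3) K))
    (hS : (S : Set (GL (Fin 3) K)) ⊆ unitaryGroup K H) (k : ℕ) {f : (Fin 2 → ℂ) → ℂ}
    (hf : IsWeightFor τ₁ Q S k f)
    {s : GL (Fin 3) K} (hs : s ∈ S) {α : GL (Fin 3) K} (hα : α ∈ unitaryGroup K H) {z : Fin 2 → ℂ}
    (hz : z ∈ ball₂) :
    slash k (realEmbedding K τ₁ Q (s * α)) f z = slash k (realEmbedding K τ₁ Q α) f z := by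
  have hαU : IsInU21 (realEmbedding K τ₁ Q α) := IsFrame.isInU21_realEmbedding hQ hα
  have hsU : IsInU21 (realEmbedding K τ₁ Q s) := IsFrame.isInU21_realEmbedding hQ (hS hs)
  have hz' : ballAction (realEmbedding K τ₁ Q α) z ∈ ball₂ := hαU.ballAction_mem_ball₂ hz
  rw [IsFrame.realEmbedding_mul hQ, slash_mul k hαU f hz]
  show (autFactor (realEmbedding K τ₁ Q α) z ^ k)⁻¹ *
      slash k (realEmbedding K τ₁ Q s) f (ballAction (realEmbedding K τ₁ Q α) z) = _
  rw [(slash_eq_self_iff (IsInU21.autFactor_ne_zero hsU hz')).mpr (hf s hs _ hz')]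
  rfl

/-- **The Hecke operator preserves weight-`k` functions for `S`.** -/
theorem IsWeightFor.hecke (hQ : IsFrame K τ₁ H Q) (S : Subgroup (GL (Fin 3) K))
    (hS : (S : Set (GL (Fin 3) K)) ⊆ unitaryGroup K H) {δ : GL (Fin 3) K} (hδ : δ ∈ unitaryGroup K H)
    [Fintype (S ⧸ (heckeSubgroup S δ).subgroupOf S)] {k : ℕ}
    {f : (Fin 2 → ℂ) → ℂ} (hf : IsWeightFor τ₁ Q S k f) :
    IsWeightFor τ₁ Q S k (hecke S δ τ₁ Q k f) := by
  intro γ hγ z hz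
  have hγU : IsInU21 (realEmbedding K τ₁ Q γ) := IsFrame.isInU21_realEmbedding hQ (hS hγ)
  unfold ShimuraData.hecke
  rw [Finset.mul_sum]
  -- each term: `(f ∥ δ r_q)(γ z) = j^k · (f ∥ (δ r_q γ))(z) = j^k · (f ∥ (δ r_{γ⁻¹ • q}))(z)`
  have hterm : ∀ q : S ⧸ (heckeSubgroup S δ).subgroupOf S,
      slash k (realEmbedding K τ₁ Q (δ * (heckeRep S δ q : GL (Fin 3) K))) f
          (ballAction (realEmbedding K τ₁ Q γ) z) =
        autFactor (realEmbedding K τ₁ Q γ) z ^ k *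
          slash k (realEmbedding K τ₁ Q (δ * (heckeRep S δ ((⟨γ, hγ⟩ : S)⁻¹ • q) : GL (Fin 3) K))) f z := by
    intro q
    rw [apply_ballAction_eq_autFactor_pow_mul_slash k _ _ hγU f hz, ← slash_mul k hγU f hz,
      ← IsFrame.realEmbedding_mul hQ]
    obtain ⟨t, ht, hrep⟩ := heckeRep_mul S δ q ⟨γ, hγ⟩
    have hmul : δ * (heckeRep S δ q : GL (Fin 3) K) * γ =
        (δ * t * δ⁻¹) * (δ * (heckeRep S δ ((⟨γ, hγ⟩ : S)⁻¹ • q) : GL (Fin 3) K)) := by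
      have : (heckeRep S δ q : GL (Fin 3) K) * γ = (t : GL (Fin 3) K) * heckeRep S δ ((⟨γ, hγ⟩ : S)⁻¹ • q) := by
        have := congrArg Subtype.val hrep
        simpa using this
      rw [mul_assoc, this]
      group
    have hmemS : δ * t * δ⁻¹ ∈ S := ((mem_heckeSubgroup S δ).mp ht).2
    have hα : δ * (heckeRep S δ ((⟨γ, hγ⟩ : S)⁻¹ • q) : GL (Fin 3) K) ∈ unitaryGroup K H :=
      (unitaryGroup K H).mul_mem hδ (hS (heckeRep S δ _).property)
    have hkey : slash k (realEmbedding K τ₁ Q (δ * (heckeRep S δ q : GL (Fin 3) K) * γ)) f z =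
        slash k (realEmbedding K τ₁ Q (δ * (heckeRep S δ ((⟨γ, hγ⟩ : S)⁻¹ • q) : GL (Fin 3) K))) f z := by
      rw [hmul]
      exact slash_mul_mem_eq hQ S hS k hf hmemS hα hz
    rw [hkey]
  simp_rw [hterm]
  -- re-index the sum along the bijection `q ↦ γ⁻¹ • q`
  exact (Equiv.sum_comp (MulAction.toPerm (⟨γ, hγ⟩⁻¹ : S)) fun q =>
    autFactor (realEmbedding K τ₁ Q γ) z ^ k *
      slash k (realEmbedding K τ₁ Q (δ * (heckeRep S δ q : GL (Fin 3) K))) f z)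

/-- The Hecke operator preserves continuity on the ball. -/
theorem continuousOn_hecke (hQ : IsFrame K τ₁ H Q) (S : Subgroup (GL (Fin 3) K))
    (hS : (S : Set (GL (Fin 3) K)) ⊆ unitaryGroup K H) {δ : GL (Fin 3) K} (hδ : δ ∈ unitaryGroup K H)
    [Fintype (S ⧸ (heckeSubgroup S δ).subgroupOf S)] (k : ℕ)
    {f : (Fin 2 → ℂ) → ℂ} (hfc : ContinuousOn f ball₂) :
    ContinuousOn (hecke S δ τ₁ Q k f) ball₂ := by
  unfold ShimuraData.hecke
  refine continuousOn_finsetSum _ fun q _ => ?_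
  exact continuousOn_slash k (IsFrame.isInU21_realEmbedding hQ
    ((unitaryGroup K H).mul_mem hδ (hS (heckeRep S δ q).property))) hfc

end Weight

end Summit.Ventures.HodgeRepro2.ShimuraData
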